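import Summits.RiemannHypothesis.RiemannHypothesis.Theorems.WeilTwoPrimeDeflE25ODef
import Summits.RiemannHypothesis.RiemannHypothesis.Theorems.WeilTwoPrimeDeflE25ODataPO29
import Literature.NumberTheory.LFunctions.WeilBlockRowsR
import HarnessLib

/-!
# Deflated two-prime certificate E25O: the materialized odd block agrees with `P_r + Σ μ ĉ ĉᵀ`, rows 30–39

`WeilCert.checkPmRowG` for certificate E25O (odd block), by `decide +kernel`. Pure proof file; nothing is asserted.
-/

set_option linter.dupNamespace false

noncomputable section

namespace Summit.RiemannHypothesis.RiemannHypothesis.Theorems.EvenWinsBeyondArch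

open Literature.NumberTheory.LFunctions

set_option maxHeartbeats 0 in
/-- Row 30 of the materialized odd block is row 30 of `P_r + Σ μ ĉ ĉᵀ` (certificate E25O). [folklore] -/
theorem checkPmRowG1_30_weilCertDeflE25O : weilCertDeflE25OBase.checkPmRowG weilCertDeflE25OP weilCertDeflE25OPmO 1 30 = true := by
  decide +kernel

set_option maxHeartbeats 0 in
/-- Row 31 of the materialized odd block is row 31 of `P_r + Σ μ ĉ ĉᵀ` (certificate E25O). [folklore] -/
theorem checkPmRowG1_31_weilCertDeflE25O : weilCertDeflE25OBase.checkPmRowG weilCertDeflE25OP weilCertDeflE25OPmO 1 31 = true := by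
  decide +kernel

set_option maxHeartbeats 0 in
/-- Row 32 of the materialized odd block is row 32 of `P_r + Σ μ ĉ ĉᵀ` (certificate E25O). [folklore] -/
theorem checkPmRowG1_32_weilCertDeflE25O : weilCertDeflE25OBase.checkPmRowG weilCertDeflE25OP weilCertDeflE25OPmO 1 32 = true := by
  decide +kernel

set_option maxHeartbeats 0 in
/-- Row 33 of the materialized odd block is row 33 of `P_r + Σ μ ĉ ĉᵀ` (certificate E25O). [folklore] -/
theorem checkPmRowG1_33_weilCertDeflE25O : weilCertDeflE25OBase.checkPmRowG weilCertDeflE25OP weilCertDeflE25OPmO 1 33 = true := by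
  decide +kernel

set_option maxHeartbeats 0 in
/-- Row 34 of the materialized odd block is row 34 of `P_r + Σ μ ĉ ĉᵀ` (certificate E25O). [folklore] -/
theorem checkPmRowG1_34_weilCertDeflE25O : weilCertDeflE25OBase.checkPmRowG weilCertDeflE25OP weilCertDeflE25OPmO 1 34 = true := by
  decide +kernel

set_option maxHeartbeats 0 in
/-- Row 35 of the materialized odd block is row 35 of `P_r + Σ μ ĉ ĉᵀ` (certificate E25O). [folklore] -/
theorem checkPmRowG1_35_weilCertDeflE25O : weilCertDeflE25OBase.checkPmRowG weilCertDeflE25OP weilCertDeflE25OPmO 1 35 = true := by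
  decide +kernel

set_option maxHeartbeats 0 in
/-- Row 36 of the materialized odd block is row 36 of `P_r + Σ μ ĉ ĉᵀ` (certificate E25O). [folklore] -/
theorem checkPmRowG1_36_weilCertDeflE25O : weilCertDeflE25OBase.checkPmRowG weilCertDeflE25OP weilCertDeflE25OPmO 1 36 = true := by
  decide +kernel

set_option maxHeartbeats 0 in
/-- Row 37 of the materialized odd block is row 37 of `P_r + Σ μ ĉ ĉᵀ` (certificate E25O). [folklore] -/
theorem checkPmRowG1_37_weilCertDeflE25O : weilCertDeflE25OBase.checkPmRowG weilCertDeflE25OP weilCertDeflE25OPmO 1 37 = true := by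
  decide +kernel

set_option maxHeartbeats 0 in
/-- Row 38 of the materialized odd block is row 38 of `P_r + Σ μ ĉ ĉᵀ` (certificate E25O). [folklore] -/
theorem checkPmRowG1_38_weilCertDeflE25O : weilCertDeflE25OBase.checkPmRowG weilCertDeflE25OP weilCertDeflE25OPmO 1 38 = true := by
  decide +kernel

set_option maxHeartbeats 0 in
/-- Row 39 of the materialized odd block is row 39 of `P_r + Σ μ ĉ ĉᵀ` (certificate E25O). [folklore] -/
theorem checkPmRowG1_39_weilCertDeflE25O : weilCertDeflE25OBase.checkPmRowG weilCertDeflE25OP weilCertDeflE25OPmO 1 39 = true := by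
  decide +kernel


end Summit.RiemannHypothesis.RiemannHypothesis.Theorems.EvenWinsBeyondArch
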